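import Literature.AlgebraicGeometry.Motives.FiberNetExistence
import Literature.AlgebraicGeometry.Motives.CurveNetExistence
import Literature.AlgebraicGeometry.Motives.SecOfForm
import Literature.AlgebraicGeometry.Motives.AbelianVarietyProofs
import Literature.AlgebraicGeometry.Motives.VarietiesRegularProofs
import Literature.AlgebraicGeometry.Motives.VarietiesDimensionProofs
import Literature.AlgebraicGeometry.Motives.VarietiesProperProofs
import Literature.AlgebraicGeometry.Resolution.BaseChangeOverOpens
import Literature.AlgebraicGeometry.Resolution.AlterationsFibresConnectedHolds
import Literature.AlgebraicGeometry.Resolution.AlterationsLemma411Vertex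
import Literature.AlgebraicGeometry.Resolution.AlterationsLemma411VertexBlowupHolds
import Literature.AlgebraicGeometry.Resolution.AlterationsLemma411Blowup
import Literature.AlgebraicGeometry.Resolution.AlterationsLemma411FibreDimension
import Literature.AlgebraicGeometry.Resolution.AlterationsLemma411SmoothLocus
import Literature.AlgebraicGeometry.Resolution.Lemma411VertexChoiceHolds
import Literature.AlgebraicGeometry.Resolution.ProjectiveSpaceSimplyConnectedHolds
import Literature.AlgebraicGeometry.Resolution.AlterationsBlowupDivisorProofs
import Literature.AlgebraicGeometry.Resolution.BlowupRegularPoints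
import Literature.AlgebraicGeometry.Resolution.RegularLocalRingsNormal
import Literature.AlgebraicGeometry.Resolution.SmoothOfRegularPerfectField
import Literature.AlgebraicGeometry.Morphisms.SteinFactorizationConnectedFibres
import Literature.AlgebraicGeometry.Morphisms.IsoOverOpen
import HarnessLib

/-!
# Nets of `r`-folds from curve nets — the induction step for `exists_fiberNet_smoothBase_nonempty`

Topic `Literature/AlgebraicGeometry/Motives`; theorems-only companion of `Motives/FiberNetExistence`
(the named fact `exists_fiberNet_smoothBase_nonempty`: for `r ≥ 1` and `X` a smooth projective
complex `(m + r)`-fold there is a net of `r`-folds `N : FiberNet r m X` over `ℙᵐ` — `Motives/SurfaceNet` —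
with non-empty smooth base). The printed source (Hartshorne II Example 7.17.3 with II Thm. 8.18, the
connectedness theorem, III Cor. 10.7) projects `X ⊂ ℙᴺ` from a general linear centre and blows up the
smooth base locus. Here the fact is PROVED, by induction on `r`, from the tree's curve nets
(`Motives/CurveNetFromLemma411`, `nonempty_fiberNet_one_of_isAlgClosed`: de Jong 1996, Lemma 4.11/4.12
for `X` itself — taken here as a HYPOTHESIS, see the last bullet) through the following induction step,
which uses de Jong's Lemma 4.11/4.12 (all leaves proved in the tree: `DeJong1996Lemma411VertexChoice_holds`,
`DeJong1996VertexBlowupProjection_holds`, `DeJong1996Lemma411Blowup_holds`,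
`DeJong1996Lemma411FibreDimension_holds`, `DeJong1996Lemma411SmoothLocusDense_holds`,
`DeJong1996SteinFactorizationEtale_holds`, `ProjectiveSpaceSimplyConnected_holds`,
`steinFactorization_geometricallyConnected_holds`) for the BASE `ℙ^{m+1}`:

* `exists_form_vanishing_of_isClosed`, `exists_isEffectiveCartier_support_superset` — every proper
  closed subset of `ℙⁿ_k` lies on a hypersurface `V₊(F)`, `deg F > 0`, an effective Cartier divisor
  with proper support (zero scheme of the section `F(x)` of `𝒪(d)`, `Motives/SecOfForm`);
* `FiberNet.nonempty_succ_of_baseChange` — **the step, as pure base change**: for a net `N` of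
  `r`-folds on `X` over `ℙ^{m+1}` (`π₁ : X₁ → ℙ^{m+1}`, smooth over `U`) and a proper `k`-morphism
  `φ : X' → ℙ^{m+1}` from a smooth projective `(m + 1)`-fold, an isomorphism off a closed
  `S ⊊ ℙ^{m+1}` with `S ⊆ U`, carrying a proper `f : X' → ℙᵐ` with geometrically connected fibres,
  the fibre product `X₂ = X₁ ×_{ℙ^{m+1}} X'` with `pr₁ ≫ σ₁` and `pr₂ ≫ f` is a net of `(r + 1)`-folds
  on `X` over `ℙᵐ` (smooth: over `ℙ^{m+1} ∖ S` an open part of `X₁`, over `U` smooth of relative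
  dimension `r` over an open part of `X'`; projective: closed in `X₁ ×_k X'`; geometrically
  irreducible: smooth and geometrically connected over `ℙᵐ`; `pr₁ ≫ σ₁` an isomorphism off the proper
  closed `F₁ ∪ σ₁(π₁⁻¹ S)`);
* `FiberNet.nonempty_succ` — over an algebraically closed field of characteristic `0`: the
  discriminant `Δ` of `N` is a proper closed subset (generic smoothness); take a hypersurface
  `Z ⊇ Δ` and de Jong's fibration of the normal projective pair `(ℙ^{m+1}, Z)` (Lemma 4.11 with d),
  and 4.12): `φ : X' = Bl_S ℙ^{m+1} → ℙ^{m+1}` with `S` finite, closed,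
  DISJOINT FROM `Z` — so `S ⊆ U` —, `f : X' → ℙᵐ` proper with geometrically connected fibres, `X'`
  regular hence smooth, projective (`BlowupProjectiveOverField_holds`);
* `nonempty_fiberNet_succ_of_curveNets` — induction on `r` from curve nets;
* `exists_fiberNet_smoothBase_nonempty_of_curveNets` — **the named fact**, over `ℂ`, GRANTED curve nets
  (with `exists_fiberNet_smoothBase_nonempty_of_forall_nonempty`: the smooth base of a net over a field
  of characteristic `0` is never empty); `exists_fiberNet_smoothBase_nonempty_of_nonempty_curveNet` — the
  same from the named fact `nonempty_curveNet` (`Motives/CurveNetExistence`) and the trivial nets over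
  `ℙ⁰`. The unconditional discharge `exists_fiberNet_smoothBase_nonempty_holds` is the one-liner feeding
  the tree's theorem `nonempty_fiberNet_one_of_isAlgClosed` (`Motives/CurveNetFromLemma411`), kept in the
  separate leaf `Motives/FiberNetExistenceDischarge` (this file does not import `CurveNetFromLemma411`).

Geometrically the step replaces "project from a linear centre of codimension `m + 1` and blow up the
base locus" by its factorisation through successive projections from points: a net of `(r+1)`-folds
over `ℙᵐ` is obtained from a net of `r`-folds over `ℙ^{m+1}` by composing with the linear projection
`ℙ^{m+1} ⇢ ℙᵐ` from a (general) point, made a morphism on the blow-up; the fibres over `ℙᵐ` are the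
unions of the `r`-fold fibres along the lines through the point.

## References

* A. J. de Jong, *Smoothness, semi-stability and alterations*, Publ. Math. IHÉS 83 (1996),
  Lemma 4.11 and 4.12, pp. 67–69. [DeJong1996]
* R. Hartshorne, *Algebraic Geometry* (1977), II Example 7.17.3, II Thm. 8.18, III Cor. 10.7.
  [Hartshorne1977]
* U. Görtz, T. Wedhorn, *Algebraic Geometry I* (2nd ed., 2020), (11.12), (13.13). [GortzWedhorn2020]
* The Stacks Project, Tags 02OS, 0377. [StacksProject]
-/

noncomputable section

open CategoryTheory CategoryTheory.Limits AlgebraicGeometry TopologicalSpace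

universe u

namespace Literature.AlgebraicGeometry.Motives

open Literature.AlgebraicGeometry.Resolution Literature.AlgebraicGeometry.Morphisms
open Literature.AlgebraicGeometry.Motives.Segre (grading toSpec)

attribute [local instance] MvPolynomial.gradedAlgebra

/-! ## Two lemmas on geometric connectedness

(Local copies of `GeometricallyConnected.connectedSpace_of_isClosedMap` /
`GeometricallyConnected.comp_of_universallyClosed` of `Motives/CurveNetFromLemma411`, which this file
does not import; Stacks 0377.) -/

/-- A closed map with (geometrically) connected fibres onto a connected scheme has connected source:
a closed continuous surjection is a quotient map (Stacks 0377). [cite: StacksProject, Tag 0377] -/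
private theorem connectedSpace_of_isClosedMap' {X S : Scheme.{u}} (f : X ⟶ S)
    [GeometricallyConnected f] [ConnectedSpace S] (hf : IsClosedMap f.base) : ConnectedSpace X := by
  have hq : Topology.IsQuotientMap f.base := hf.isQuotientMap f.continuous f.surjective
  have h := hq.isCoinducing.isConnected_preimage_of_isClosed f.isConnected_preimage_singleton
    isClosed_univ isConnected_univ
  rw [Set.preimage_univ] at h
  exact connectedSpace_iff_univ.mpr h

/-- A universally closed morphism with geometrically connected fibres followed by a morphism with
geometrically connected fibres has geometrically connected fibres (Stacks 0377; Mathlib's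
`GeometricallyConnected.comp` is the universally open variant). [cite: StacksProject, Tag 0377] -/
private theorem geometricallyConnected_comp_of_universallyClosed' {X Y Z : Scheme.{u}} (f : X ⟶ Y)
    (g : Y ⟶ Z) [GeometricallyConnected f] [UniversallyClosed f] [GeometricallyConnected g] :
    GeometricallyConnected (f ≫ g) := by
  refine ⟨geometrically_iff_of_isClosedUnderIsomorphisms.mpr fun K _ x ↦ ?_⟩
  rw [← (pullbackRightPullbackFstIso g x f).hom.homeomorph.connectedSpace_iff]
  haveI : ConnectedSpace ↥(pullback g x) :=
    pullback_of_geometrically GeometricallyConnected.geometrically_connectedSpace K x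
  exact connectedSpace_of_isClosedMap' (pullback.snd f (pullback.fst g x))
    (pullback.snd f (pullback.fst g x)).isClosedMap

/-! ## Hypersurfaces through a proper closed subset of projective space -/

/-- A homogeneous component of an element missing a relevant prime `𝔭_x` misses it, in some
degree. [folklore] -/
theorem exists_proj_notMem {k : Type u} [Field k] {n : ℕ} (x : ↥(Proj (grading (Fin (n + 1)) k)))
    {f : MvPolynomial (Fin (n + 1)) k} (hf : f ∉ x.asHomogeneousIdeal) :
    ∃ i, GradedRing.proj (grading (Fin (n + 1)) k) i f ∉ x.asHomogeneousIdeal := by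
  classical
  by_contra H
  push Not at H
  apply hf
  rw [← DirectSum.sum_support_decompose (grading (Fin (n + 1)) k) f]
  exact Ideal.sum_mem _ fun i _ => H i

/-- Homogeneous components are forms of the corresponding degree. [folklore] -/
theorem isHomogeneous_proj {k : Type u} [Field k] {n : ℕ} (i : ℕ) (f : MvPolynomial (Fin (n + 1)) k) :
    (GradedRing.proj (grading (Fin (n + 1)) k) i f).IsHomogeneous i := by
  have h : GradedRing.proj (grading (Fin (n + 1)) k) i f ∈ grading (Fin (n + 1)) k i := by
    rw [GradedRing.proj_apply]
    exact SetLike.coe_mem _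
  exact (MvPolynomial.mem_homogeneousSubmodule i _).mp h

/-- A form of degree `0` lying in a relevant prime is `0` (it is a constant, and `𝔭_z ≠ ⊤`).
[folklore] -/
theorem eq_zero_of_isHomogeneous_zero_of_mem {k : Type u} [Field k] {n : ℕ}
    (z : ↥(Proj (grading (Fin (n + 1)) k))) {F : MvPolynomial (Fin (n + 1)) k}
    (hF : F.IsHomogeneous 0) (hFz : F ∈ z.asHomogeneousIdeal) : F = 0 := by
  by_contra hF0
  have hFC : F = MvPolynomial.C (MvPolynomial.coeff 0 F) :=
    MvPolynomial.totalDegree_eq_zero_iff_eq_C.mp (Nat.le_zero.mp hF.totalDegree_le)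
  have hc : MvPolynomial.coeff 0 F ≠ 0 := by
    intro hc
    exact hF0 (by rw [hFC, hc, map_zero])
  have hunit : IsUnit F := by
    rw [hFC]
    exact (isUnit_iff_ne_zero.mpr hc).map MvPolynomial.C
  exact z.isPrime.ne_top (Ideal.eq_top_of_isUnit_mem _ hFz hunit)

/-- **Every proper closed subset of `ℙⁿ_k` lies on a hypersurface**: for a closed `Z ⊊ ℙⁿ_k` there
is a form `F` of positive degree vanishing on `Z` (i.e. `F ∈ 𝔭_z` for all `z ∈ Z`) and not
vanishing at some point `x`. (`Z = V₊(s)`; a point `x ∉ Z` misses some `f ∈ s` — or, if `Z = ∅`,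
some `f` of the irrelevant ideal —, hence some homogeneous component `F` of `f`, while every
`𝔭_z`, `z ∈ Z`, is homogeneous and contains `f`; `deg F > 0` because a non-zero constant lies in no
relevant prime.) [folklore] -/
theorem exists_form_vanishing_of_isClosed {k : Type u} [Field k] {n : ℕ}
    {Z : Set ↥(Proj (grading (Fin (n + 1)) k))} (hZ : IsClosed Z) (hZu : Z ≠ Set.univ) :
    ∃ (d : ℕ) (F : MvPolynomial (Fin (n + 1)) k), 0 < d ∧ F.IsHomogeneous d ∧
      (∀ z ∈ Z, F ∈ z.asHomogeneousIdeal) ∧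
        ∃ x : ↥(Proj (grading (Fin (n + 1)) k)), F ∉ x.asHomogeneousIdeal := by
  classical
  obtain ⟨x, hx⟩ : ∃ x, x ∉ Z := by
    by_contra h
    push Not at h
    exact hZu (Set.eq_univ_of_forall h)
  by_cases hZe : Z = ∅
  · -- a homogeneous component of positive degree of an element of the irrelevant ideal missing `𝔭_x`
    obtain ⟨f, hf, hfx⟩ : ∃ f, f ∈ HomogeneousIdeal.irrelevant (grading (Fin (n + 1)) k) ∧
        f ∉ x.asHomogeneousIdeal := by
      have h := x.not_irrelevant_le
      contrapose! h
      exact fun f hf => h f hf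
    obtain ⟨i, hi⟩ := exists_proj_notMem x hfx
    have hi0 : i ≠ 0 := by
      rintro rfl
      rw [HomogeneousIdeal.mem_irrelevant_iff] at hf
      exact hi (hf ▸ Submodule.zero_mem _)
    exact ⟨i, _, Nat.pos_of_ne_zero hi0, isHomogeneous_proj i f, by simp [hZe], x, hi⟩
  · obtain ⟨s, rfl⟩ := (ProjectiveSpectrum.isClosed_iff_zeroLocus _ Z).mp hZ
    obtain ⟨f, hfs, hfx⟩ : ∃ f ∈ s, f ∉ x.asHomogeneousIdeal := by
      by_contra h
      push Not at h
      exact hx ((ProjectiveSpectrum.mem_zeroLocus _ x s).mpr h)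
    obtain ⟨i, hi⟩ := exists_proj_notMem x hfx
    have hFZ : ∀ z ∈ ProjectiveSpectrum.zeroLocus (grading (Fin (n + 1)) k) s,
        GradedRing.proj (grading (Fin (n + 1)) k) i f ∈ z.asHomogeneousIdeal := by
      intro z hz
      have hfz : f ∈ z.asHomogeneousIdeal := (ProjectiveSpectrum.mem_zeroLocus _ z s).mp hz hfs
      exact z.1.2 i hfz
    refine ⟨i, _, ?_, isHomogeneous_proj i f, hFZ, x, hi⟩
    -- `deg F > 0`: a form of degree `0` in some `𝔭_z` (`Z ≠ ∅`) would vanish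
    rcases Nat.eq_zero_or_pos i with h0 | hpos
    · exfalso
      obtain ⟨z, hz⟩ := Set.nonempty_iff_ne_empty.mpr hZe
      have hF0 := eq_zero_of_isHomogeneous_zero_of_mem z (h0 ▸ isHomogeneous_proj i f) (hFZ z hz)
      exact hi (hF0 ▸ Submodule.zero_mem _)
    · exact hpos

/-- **Every proper closed subset `Δ ⊊ ℙⁿ_k` lies in the support of an effective Cartier divisor with
proper support** — the hypersurface `V₊(F)` of `exists_form_vanishing_of_isClosed`, as the zero
scheme of the section `F(x₀, …, xₙ)` of `𝒪(d)` (`GeneratingSections.secOfForm` for the data of the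
identity of `ℙⁿ`; effective Cartier because `ℙⁿ_k` is integral and the support is not everything,
`Sec.isEffectiveCartier_zeroIdeal_of_isIntegral`). [cite: GortzWedhorn2020, (11.12) p. 379 and (13.13) p. 505] -/
theorem exists_isEffectiveCartier_support_superset {k : Type u} [Field k] (n : ℕ)
    {Δ : Set ↥(Proj (grading (Fin (n + 1)) k))} (hΔ : IsClosed Δ) (hΔu : Δ ≠ Set.univ) :
    ∃ D : (Proj (grading (Fin (n + 1)) k)).IdealSheafData, IsEffectiveCartier D ∧
      Δ ⊆ (D.support : Set ↥(Proj (grading (Fin (n + 1)) k))) ∧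
        (D.support : Set ↥(Proj (grading (Fin (n + 1)) k))) ≠ Set.univ := by
  obtain ⟨d, F, hd, hF, hFΔ, x, hx⟩ := exists_form_vanishing_of_isClosed (k := k) (n := n) hΔ hΔu
  let r : Proj (grading (Fin (n + 1)) k) ⟶ Proj (grading (Fin (n + 1)) k) := 𝟙 _
  have hr : r ≫ toSpec (Fin (n + 1)) k = toSpec (Fin (n + 1)) k := Category.id_comp _
  have hrx : ∀ y, r y = y := fun y => rfl
  haveI : IsAffineHom r := by change IsAffineHom (𝟙 _); infer_instance
  haveI : IsSeparated (toSpec (Fin (n + 1)) k) := by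
    rw [← projectiveSpace_hom_eq_toSpec]
    exact CurveNet.isSeparated_projectiveSpace_hom n k
  haveI : QuasiSeparatedSpace ↥(Proj (grading (Fin (n + 1)) k)) :=
    quasiSeparatedSpace_of_quasiSeparated (toSpec (Fin (n + 1)) k)
  haveI : IsIntegral (Proj (grading (Fin (n + 1)) k)) := isIntegral_projectiveSpace (n := n) (k := k)
  let t := (GeneratingSections.ofHom r).secOfForm (toSpec (Fin (n + 1)) k) F hF
  have hmem : ∀ y : ↥(Proj (grading (Fin (n + 1)) k)),
      y ∈ t.zeroIdeal.support ↔ F ∈ y.asHomogeneousIdeal := fun y => by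
    rw [GeneratingSections.mem_support_zeroIdeal_secOfForm_ofHom_iff (toSpec (Fin (n + 1)) k) r hr
      hd F hF y, hrx]
  have hne : (t.zeroIdeal.support : Set ↥(Proj (grading (Fin (n + 1)) k))) ≠ Set.univ := by
    intro h
    have hx' : x ∈ (t.zeroIdeal.support : Set ↥(Proj (grading (Fin (n + 1)) k))) :=
      h ▸ Set.mem_univ x
    exact hx ((hmem x).mp hx')
  refine ⟨t.zeroIdeal, ?_, fun z hz => (hmem z).mpr (hFΔ z hz), hne⟩
  exact t.isEffectiveCartier_zeroIdeal_of_isIntegral (GeneratingSections.isAffineOpen_ofHom_U r) hne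

/-! ## The induction step: base change of a net along a modification of the base fibred over `ℙᵐ`

Let `N` be a net of `r`-folds on `X` over `ℙ^{m+1}_k` (`π₁ : X₁ → ℙ^{m+1}`, smooth over the
smooth base `U`), and let `φ : X' → ℙ^{m+1}` be a proper `k`-morphism from a smooth projective
`(m + 1)`-fold which is an isomorphism off a closed `S ⊊ ℙ^{m+1}` CONTAINED IN `U`, together with
a proper `k`-morphism `f : X' → ℙᵐ` with geometrically connected fibres (in the application:
de Jong's Lemma 4.11 fibration of `ℙ^{m+1}` blown up in finitely many points of `U`). Then the
fibre product `X₂ = X₁ ×_{ℙ^{m+1}} X'` with `σ₂ = pr₁ ≫ σ₁ : X₂ → X` and `π₂ = pr₂ ≫ f : X₂ → ℙᵐ`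
is a net of `(r + 1)`-folds on `X`:

* `X₂` is smooth over `k` of relative dimension `m + r + 1`: over `ℙ^{m+1} ∖ S` it is an open
  part of `X₁` (`pr₁` is an isomorphism there, base change of `φ`), and over `U` the projection
  `pr₂` is smooth of relative dimension `r` (base change of `π₁|_U`) onto an open part of the
  smooth `X'`; the two parts cover since `S ⊆ U`;
* `X₂` is projective (a closed subscheme of `X₁ ×_k X'`, Segre) and geometrically irreducible
  (smooth, and geometrically connected: `π₂` is universally closed with geometrically connected
  fibres — `pr₂` is a base change of `π₁`, `f` is geometrically connected);
* `σ₂` is an isomorphism off `F₁ ∪ σ₁(π₁⁻¹ S)`, a proper closed subset of `X`.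
-/

section Step

variable {k : Type u} [Field k] {r m : ℕ} {X : SchemeOver k}

/-- The image of a non-empty open subset of the (irreducible) total space of a net under the net
map is dense in `ℙᵐ`; hence a closed subset of `ℙᵐ` containing it is everything. [folklore] -/
theorem FiberNet.eq_univ_of_image_subset {m : ℕ} (N : FiberNet r m X) {W : Set ↥N.total.left}
    (hW : IsOpen W) (hWne : W.Nonempty) {S : Set ↥(projectiveSpace m k).left} (hS : IsClosed S)
    (h : N.proj.left.base '' W ⊆ S) : S = Set.univ := by
  haveI := N.irreducibleSpace_total
  have hd : Dense W := hW.dense hWne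
  have h1 : N.proj.left.base '' closure W ⊆ closure (N.proj.left.base '' W) :=
    image_closure_subset_closure_image N.proj.left.continuous
  rw [hd.closure_eq, Set.image_univ_of_surjective N.surjective_proj] at h1
  exact Set.eq_univ_of_univ_subset ((h1.trans (closure_mono h)).trans hS.closure_eq.subset)

/-- **The induction step** (module docstring): from a net of `r`-folds over `ℙ^{m+1}` and a
modification `φ : X' → ℙ^{m+1}` of the base — an isomorphism off a closed `S ⊊ ℙ^{m+1}` inside
the smooth base, `X'` smooth projective of dimension `m + 1` — carrying a proper `f : X' → ℙᵐ`
with geometrically connected fibres, the fibre product `X₁ ×_{ℙ^{m+1}} X'` is a net of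
`(r + 1)`-folds on `X` over `ℙᵐ`. [folklore] -/
theorem FiberNet.nonempty_succ_of_baseChange [IsSeparated X.hom] (N : FiberNet r (m + 1) X)
    {X' : Scheme.{u}} (φ : X' ⟶ (projectiveSpace (m + 1) k).left)
    (f : X' ⟶ (projectiveSpace m k).left)
    (hf : f ≫ (projectiveSpace m k).hom = φ ≫ (projectiveSpace (m + 1) k).hom)
    [IsProper φ] [IsProper f] [GeometricallyConnected f]
    [SmoothOfRelativeDimension (m + 1) (φ ≫ (projectiveSpace (m + 1) k).hom)]
    (hX' : IsProjectiveOver (Over.mk (φ ≫ (projectiveSpace (m + 1) k).hom)))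
    {S : Set ↥(projectiveSpace (m + 1) k).left} (hS : IsClosed S) (hSne : S ≠ Set.univ)
    (hSU : S ⊆ (N.smoothBase : Set ↥(projectiveSpace (m + 1) k).left))
    [IsIso (φ ∣_ (⟨Sᶜ, hS.isOpen_compl⟩ : (projectiveSpace (m + 1) k).left.Opens))] :
    Nonempty (FiberNet (r + 1) m X) := by
  classical
  -- notation
  set π₁ : N.total.left ⟶ (projectiveSpace (m + 1) k).left := N.proj.left with hπ₁
  haveI : IsProper π₁ := N.isProper_proj
  set p₁ : pullback π₁ φ ⟶ N.total.left := pullback.fst π₁ φ with hp₁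
  set p₂ : pullback π₁ φ ⟶ X' := pullback.snd π₁ φ with hp₂
  have hc : p₁ ≫ π₁ = p₂ ≫ φ := pullback.condition
  set b : N.total.left ⟶ X.left := N.blowDown.left with hb
  haveI : IsProper b := N.isProper_blowDown
  let Sc : (projectiveSpace (m + 1) k).left.Opens := ⟨Sᶜ, hS.isOpen_compl⟩
  let U : (projectiveSpace (m + 1) k).left.Opens := N.smoothBase
  -- the structure square
  have hw : p₁ ≫ N.total.hom = p₂ ≫ φ ≫ (projectiveSpace (m + 1) k).hom := by
    rw [← Over.w N.proj, ← Category.assoc, ← hπ₁, hc, Category.assoc]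
  let T : SchemeOver k := Over.mk (p₂ ≫ φ ≫ (projectiveSpace (m + 1) k).hom)
  let σ : T ⟶ X := Over.homMk (p₁ ≫ b) (by
    change (p₁ ≫ b) ≫ X.hom = p₂ ≫ φ ≫ (projectiveSpace (m + 1) k).hom
    rw [Category.assoc, hb, Over.w N.blowDown, hw])
  let π : T ⟶ projectiveSpace m k := Over.homMk (p₂ ≫ f) (by
    change (p₂ ≫ f) ≫ (projectiveSpace m k).hom = p₂ ≫ φ ≫ (projectiveSpace (m + 1) k).hom
    rw [Category.assoc, hf])
  /- (1) smoothness of relative dimension `m + (r + 1)` -/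
  haveI hN := N.isSmoothProjective_total.smoothOfRelativeDimension
  haveI := smoothOfRelativeDimension_isStableUnderBaseChange (n := r)
  -- over `ℙ^{m+1} ∖ S`: `pr₁` is an isomorphism onto an open part of `X₁`
  haveI hiso₁ : IsIso (p₁ ∣_ π₁ ⁻¹ᵁ Sc) := isIso_morphismRestrict_pullback_fst π₁ φ Sc
  -- over `U`: `pr₂` is smooth of relative dimension `r`
  have hsm₂ : SmoothOfRelativeDimension r (p₂ ∣_ φ ⁻¹ᵁ U) :=
    pullback_snd_morphismRestrict (@SmoothOfRelativeDimension r) π₁ φ U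
      (N.smoothOfRelativeDimension_restrict U N.smooth_proj_restrict)
  let V : Bool → (pullback π₁ φ).Opens := fun i => cond i (p₁ ⁻¹ᵁ (π₁ ⁻¹ᵁ Sc)) (p₂ ⁻¹ᵁ (φ ⁻¹ᵁ U))
  have hcov : iSup V = ⊤ := by
    rw [eq_top_iff]
    rintro x -
    rw [Opens.mem_iSup]
    by_cases hx : φ (p₂ x) ∈ S
    · exact ⟨false, show φ (p₂ x) ∈ U from hSU hx⟩
    · refine ⟨true, ?_⟩
      change π₁ (p₁ x) ∈ Sᶜ
      rwa [← Scheme.Hom.comp_apply, hc, Scheme.Hom.comp_apply]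
  haveI hsmT : SmoothOfRelativeDimension (m + (r + 1)) T.hom := by
    change SmoothOfRelativeDimension (m + (r + 1)) (p₂ ≫ φ ≫ (projectiveSpace (m + 1) k).hom)
    refine IsZariskiLocalAtSource.of_iSup_eq_top (P := @SmoothOfRelativeDimension (m + (r + 1)))
      V hcov ?_
    rintro (_ | _)
    · -- `false`: over `U`
      change SmoothOfRelativeDimension (m + (r + 1)) ((p₂ ⁻¹ᵁ (φ ⁻¹ᵁ U)).ι ≫ p₂ ≫ φ ≫ (projectiveSpace (m + 1) k).hom)
      have h : SmoothOfRelativeDimension (r + (0 + (m + 1)))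
          ((p₂ ∣_ φ ⁻¹ᵁ U) ≫ (φ ⁻¹ᵁ U).ι ≫ φ ≫ (projectiveSpace (m + 1) k).hom) := by
        haveI := hsm₂
        infer_instance
      rw [← Category.assoc (p₂ ∣_ φ ⁻¹ᵁ U), morphismRestrict_ι, Category.assoc] at h
      have e : r + (0 + (m + 1)) = m + (r + 1) := by omega
      exact e ▸ h
    · -- `true`: over `ℙ^{m+1} ∖ S`
      change SmoothOfRelativeDimension (m + (r + 1)) ((p₁ ⁻¹ᵁ (π₁ ⁻¹ᵁ Sc)).ι ≫ p₂ ≫ φ ≫ (projectiveSpace (m + 1) k).hom)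
      rw [← hw]
      have h : SmoothOfRelativeDimension (0 + (0 + (m + 1 + r)))
          ((p₁ ∣_ π₁ ⁻¹ᵁ Sc) ≫ (π₁ ⁻¹ᵁ Sc).ι ≫ N.total.hom) := inferInstance
      rw [← Category.assoc (p₁ ∣_ π₁ ⁻¹ᵁ Sc), morphismRestrict_ι, Category.assoc] at h
      have e : 0 + (0 + (m + 1 + r)) = m + (r + 1) := by omega
      exact e ▸ h
  /- (2) projectivity -/
  haveI : IsSeparated (projectiveSpace (m + 1) k).hom :=
    CurveNet.isSeparated_projectiveSpace_hom (m + 1) k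
  have hproj : IsProjectiveOver T := by
    have hNt : IsProjectiveOver (Over.mk (π₁ ≫ (projectiveSpace (m + 1) k).hom)) := by
      have e : Over.mk (π₁ ≫ (projectiveSpace (m + 1) k).hom) = N.total := by
        rw [hπ₁, Over.w N.proj]; rfl
      rw [e]
      exact N.isSmoothProjective_total.isProjectiveOver
    exact isProjectiveOver_pullback π₁ (projectiveSpace (m + 1) k).hom φ
      (φ ≫ (projectiveSpace (m + 1) k).hom) rfl hNt hX'
  /- (3) geometric connectedness of `π₂ = pr₂ ≫ f`, geometric irreducibility of `X₂` -/
  haveI : GeometricallyConnected p₂ := inferInstance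
  haveI hgc : GeometricallyConnected (p₂ ≫ f) := geometricallyConnected_comp_of_universallyClosed' p₂ f
  haveI : UniversallyClosed (p₂ ≫ f) := inferInstance
  haveI : GeometricallyConnected T.hom := by
    -- `X₂ → ℙᵐ → Spec k`: `ℙᵐ` is geometrically irreducible, hence geometrically connected, over `k`
    haveI := (isSmoothProjective_projectiveSpace_holds k m).geometricallyIrreducible
    haveI : GeometricallyConnected (projectiveSpace m k).hom :=
      geometricallyConnected_of_geometricallyIrreducible _
    change GeometricallyConnected (p₂ ≫ φ ≫ (projectiveSpace (m + 1) k).hom)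
    rw [← hf, ← Category.assoc]
    exact geometricallyConnected_comp_of_universallyClosed' _ _
  have hT : IsSmoothProjective (m + (r + 1)) T :=
    ⟨hsmT, hproj,
      geometricallyIrreducible_of_geometricallyConnected_of_smoothOfRelativeDimension T.hom
        (m + (r + 1))⟩
  /- (4) the base locus `F₁ ∪ σ₁(π₁⁻¹ S)` and the isomorphism off it -/
  let B : Set ↥X.left := N.baseLocus ∪ b.base '' (π₁.base ⁻¹' S)
  have hB : IsClosed B := N.isClosed_baseLocus.union (b.isClosedMap _ (hS.preimage π₁.continuous))
  have hBne : B ≠ Set.univ := by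
    intro hBu
    -- `σ₁⁻¹(X ∖ F₁)` is a non-empty open of `X₁` mapping into `S` under `π₁`
    apply hSne
    refine N.eq_univ_of_image_subset (b ⁻¹ᵁ N.offBaseLocus).isOpen ?_ hS ?_
    · obtain ⟨x, hx⟩ := N.offBaseLocus_nonempty
      obtain ⟨y, hy⟩ := N.compl_baseLocus_subset_range_blowDown hx
      exact ⟨y, show b.base y ∈ N.offBaseLocus from hy ▸ hx⟩
    · rintro _ ⟨y, hy, rfl⟩
      have hby : b.base y ∈ B := hBu ▸ Set.mem_univ _
      rcases hby with h₁ | ⟨y', hy', hyy'⟩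
      · exact absurd h₁ hy
      · -- `σ₁` is injective over `X ∖ F₁`
        have hy'V : y' ∈ b ⁻¹ᵁ N.offBaseLocus := by
          change b.base y' ∈ N.offBaseLocus
          rw [hyy']
          exact hy
        have hinj : Function.Injective (b ∣_ N.offBaseLocus).base :=
          (TopCat.homeoOfIso (Scheme.forgetToTop.mapIso (asIso (b ∣_ N.offBaseLocus)))).injective
        have heq : (⟨y', hy'V⟩ : ↥(b ⁻¹ᵁ N.offBaseLocus)) = ⟨y, hy⟩ := by
          apply hinj
          apply Subtype.ext
          change ((b ∣_ N.offBaseLocus).base ⟨y', hy'V⟩).1 = ((b ∣_ N.offBaseLocus).base ⟨y, hy⟩).1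
          rw [morphismRestrict_base_coe, morphismRestrict_base_coe]
          exact hyy'
        have : y' = y := congrArg Subtype.val heq
        exact this ▸ hy'
  let Bc : X.left.Opens := ⟨Bᶜ, hB.isOpen_compl⟩
  have hBc₁ : Bc ≤ N.offBaseLocus := fun x hx h => hx (Or.inl h)
  have hBc₂ : b ⁻¹ᵁ Bc ≤ π₁ ⁻¹ᵁ Sc := by
    intro y hy hyS
    exact hy (Or.inr ⟨y, hyS, rfl⟩)
  haveI : IsIso (b ∣_ Bc) := isIso_morphismRestrict_of_le b hBc₁
  haveI : IsIso (p₁ ∣_ b ⁻¹ᵁ Bc) := isIso_morphismRestrict_of_le p₁ hBc₂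
  have hσ : IsIso (σ.left ∣_ Bc) := by
    change IsIso ((p₁ ≫ b) ∣_ Bc)
    exact isIso_morphismRestrict_comp p₁ b Bc
  /- (5) the net -/
  exact ⟨{ total := T
           isSmoothProjective_total := hT
           blowDown := σ
           baseLocus := B
           isClosed_baseLocus := hB
           baseLocus_ne_univ := hBne
           isIso_blowDown_restrict := hσ
           proj := π
           geometricallyConnected_proj := hgc
           smoothOfRelativeDimension_restrict := fun W hW =>
             smoothOfRelativeDimension_morphismRestrict_of_isSmoothProjective hT π W hW }⟩

end Step

/-! ## The step over an algebraically closed field of characteristic zero, via de Jong's Lemma 4.11 -/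

section DeJong

variable {k : Type u} [Field k] [IsAlgClosed k] [CharZero k] {r m : ℕ} {X : SchemeOver k}

/-- **From nets of `r`-folds over `ℙ^{m+1}` to nets of `(r + 1)`-folds over `ℙᵐ`** (`k`
algebraically closed of characteristic `0`, `X` separated over `k`). Let `N` be a net of
`r`-folds on `X` over `ℙ^{m+1}` with discriminant `Δ ⊊ ℙ^{m+1}` (generic smoothness,
`discriminant_ne_univ_of_charZero`). Choose a hypersurface `Z = V₊(F) ⊇ Δ`, an effective Cartier
divisor with proper support (`exists_isEffectiveCartier_support_superset`), and apply de Jong's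
Lemma 4.11/4.12 to the normal projective pair `(ℙ^{m+1}, Z)` (assembled from the discharged leaves
of `Resolution/AlterationsLemma411*`, `Resolution/AlterationsFibresConnected*`): the blowing up
`φ : X' → ℙ^{m+1}` in a finite set `S` of closed points DISJOINT FROM `Z`, hence inside the smooth
base `U = ℙ^{m+1} ∖ Δ`, with a proper `f : X' → ℙᵐ` over `k` all of whose fibres are
geometrically connected; `X'` is regular (Liu 8.1.19 (a) over `S`, `IsBlowup.isRegularLocalRing_stalk_of_finite`;
a local isomorphism off `S`), hence smooth over the
perfect `k`, of relative dimension `m + 1`, and projective (`BlowupProjectiveOverField_holds`),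
and `φ` is an isomorphism off `S ⊊ ℙ^{m+1}`. The induction step
`FiberNet.nonempty_succ_of_baseChange` then yields a net of `(r + 1)`-folds on `X` over `ℙᵐ`.
[cite: DeJong1996, Lemma 4.11 and 4.12, pp. 67–69] [cite: Hartshorne1977, II Example 7.17.3] -/
theorem FiberNet.nonempty_succ [IsSeparated X.hom] (N : FiberNet r (m + 1) X) :
    Nonempty (FiberNet (r + 1) m X) := by
  classical
  -- the base `ℙ^{m+1}`: integral, projective, regular of dimension `m + 1`
  haveI hint : IsIntegral (projectiveSpace (m + 1) k).left :=
    isIntegral_projectiveSpace (n := m + 1) (k := k)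
  have hproj : IsProjectiveOver (Over.mk (projectiveSpace (m + 1) k).hom) :=
    isProjectiveOver_projectiveSpace (m + 1) k
  haveI hPsm : SmoothOfRelativeDimension (m + 1) (projectiveSpace (m + 1) k).hom :=
    (isSmoothProjective_projectiveSpace_holds k (m + 1)).smoothOfRelativeDimension
  haveI : Smooth (projectiveSpace (m + 1) k).hom := SmoothOfRelativeDimension.smooth (m + 1) _
  haveI : LocallyOfFiniteType (projectiveSpace (m + 1) k).hom := inferInstance
  haveI : IsLocallyNoetherian (projectiveSpace (m + 1) k).left :=
    LocallyOfFiniteType.isLocallyNoetherian (projectiveSpace (m + 1) k).hom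
  haveI : Nonempty ↥(projectiveSpace (m + 1) k).left := N.nonempty_base
  have hreg : ∀ x : ↥(projectiveSpace (m + 1) k).left,
      IsRegularLocalRing ((projectiveSpace (m + 1) k).left.presheaf.stalk x) := fun x =>
    isRegularLocalRing_stalk_of_smoothOfRelativeDimension (projectiveSpace (m + 1) k).hom (m + 1) x
  have hdim : topologicalKrullDim ↥(projectiveSpace (m + 1) k).left = (m + 1 : ℕ) :=
    topologicalKrullDim_eq_of_smoothOfRelativeDimension (projectiveSpace (m + 1) k).hom (m + 1)
  -- a hypersurface `Z ⊇ Δ`, an effective Cartier divisor with proper support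
  obtain ⟨D, hD, hΔZ, hZne⟩ := exists_isEffectiveCartier_support_superset (k := k) (m + 1)
    N.isClosed_discriminant N.discriminant_ne_univ_of_charZero
  set Z : Set ↥(projectiveSpace (m + 1) k).left :=
    (D.support : Set ↥(Proj (grading (Fin (m + 1 + 1)) k))) with hZdef
  have hZ : ∃ D' : (projectiveSpace (m + 1) k).left.IdealSheafData, IsEffectiveCartier D' ∧
      (D'.support : Set ↥(projectiveSpace (m + 1) k).left) = Z := ⟨D, hD, rfl⟩
  have hP : DeJong1996.NormalProjectivePair (projectiveSpace (m + 1) k).hom Z :=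
    ⟨hint, hproj, hZ, fun x => by haveI := hreg x; exact isIntegrallyClosed_of_isRegularLocalRing _⟩
  -- de Jong's Lemma 4.11 for `(ℙ^{m+1}, Z)`, with d) (`ℙ^{m+1}` is normal), and 4.12
  have h411 : DeJong1996Lemma411.{u} :=
    DeJong1996Lemma411.of_vertexBlowupProjection_of_vertexChoice_of_construction
      DeJong1996VertexBlowupProjection_holds DeJong1996Lemma411VertexChoice_holds
      DeJong1996Lemma411Blowup_holds DeJong1996Lemma411FibreDimension_holds
      DeJong1996Lemma411SmoothLocusDense_holds
  have h412 : DeJong1996FibresGeometricallyConnected.{u} :=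
    DeJong1996FibresGeometricallyConnected.of_steinEtale_of_simplyConnected
      steinFactorization_geometricallyConnected_holds DeJong1996SteinFactorizationEtale_holds
      ProjectiveSpaceSimplyConnected_holds
  obtain ⟨-, h⟩ := h411 k (projectiveSpace (m + 1) k).left (projectiveSpace (m + 1) k).hom
    Z m hint hproj hZ hdim
  obtain ⟨X', φ, f, hF, hy⟩ := h hP.isIntegrallyClosed
  haveI hgc : GeometricallyConnected f := h412 k
    (projectiveSpace (m + 1) k).left (projectiveSpace (m + 1) k).hom Z m X' φ f hP hdim hF hy
  haveI : IsProper f := hF.isProper hP hdim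
  haveI hint' : IsIntegral X' := (hF.isAlteration hP hdim).isIntegral
  haveI : IsProper φ := (hF.isAlteration hP hdim).isProper
  obtain ⟨S, hS, hSf, hSc, -, hSZ, hblow⟩ := hF.exists_isBlowup
  set J := Scheme.IdealSheafData.vanishingIdeal (⟨S, hS⟩ : Closeds ↥(projectiveSpace (m + 1) k).left)
    with hJ
  have h1 : (1 : WithBot ℕ∞) ≤ topologicalKrullDim ↥(projectiveSpace (m + 1) k).left := by
    rw [hdim]
    exact_mod_cast Nat.succ_le_succ (Nat.zero_le m)
  have hJne : J ≠ ⊥ := vanishingIdeal_ne_bot_of_forall_isClosed h1 hS hSc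
  -- `S ⊊ ℙ^{m+1}`, `S ⊆ U`, and `φ` is an isomorphism off `S`
  have hSne : S ≠ Set.univ := by
    obtain ⟨x, hx⟩ := centreCompl_nonempty (J := J) hJne
    intro hSu
    apply hx
    rw [hJ, Scheme.IdealSheafData.coe_support_vanishingIdeal]
    exact hSu ▸ Set.mem_univ x
  have hSU : S ⊆ (N.smoothBase : Set ↥(projectiveSpace (m + 1) k).left) := by
    intro s hs
    rw [N.coe_smoothBase]
    exact fun hsΔ => Set.disjoint_left.mp hSZ hs (hΔZ hsΔ)
  have hopens : (⟨Sᶜ, hS.isOpen_compl⟩ : (projectiveSpace (m + 1) k).left.Opens) = centreCompl J := by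
    ext x
    change x ∈ Sᶜ ↔ x ∈ ((J.support : Set ↥(projectiveSpace (m + 1) k).left))ᶜ
    rw [hJ, Scheme.IdealSheafData.coe_support_vanishingIdeal]
    rfl
  haveI : IsIso (φ ∣_ (⟨Sᶜ, hS.isOpen_compl⟩ : (projectiveSpace (m + 1) k).left.Opens)) := by
    rw [hopens]
    exact hblow.isIso_compl
  -- `X'` is regular, hence smooth over the perfect field `k`, of relative dimension `m + 1`
  have hreg' : ∀ x' : X', IsRegularLocalRing (X'.presheaf.stalk x') := by
    -- over `S` by Liu 8.1.19 (a); off `S` the blowing up is a local isomorphism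
    intro x'
    by_cases hx : φ x' ∈ S
    · have hRo : IsOpen (Scheme.regularLocus (projectiveSpace (m + 1) k).left) := by
        have : Scheme.regularLocus (projectiveSpace (m + 1) k).left = Set.univ :=
          Set.eq_univ_of_forall fun x => hreg x
        rw [this]
        exact isOpen_univ
      exact hblow.isRegularLocalRing_stalk_of_finite hRo hS hSf hSc (fun x _ => hreg x) hx
    · let W : X'.Opens := φ ⁻¹ᵁ centreCompl J
      have hx' : x' ∈ W := by
        change φ x' ∈ ((J.support : Set ↥(projectiveSpace (m + 1) k).left))ᶜ
        rw [hJ, Scheme.IdealSheafData.coe_support_vanishingIdeal]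
        exact hx
      haveI hoi : IsOpenImmersion (W.ι ≫ φ) := hblow.isOpenImmersion_preimage_compl_ι
      have h2 : IsIso (φ.stalkMap x' ≫ W.ι.stalkMap ⟨x', hx'⟩) := by
        have h3 : IsIso ((W.ι ≫ φ).stalkMap ⟨x', hx'⟩) := inferInstance
        rw [Scheme.Hom.stalkMap_comp] at h3
        exact h3
      have h4 : IsIso (W.ι.stalkMap ⟨x', hx'⟩) := inferInstance
      haveI : IsIso (φ.stalkMap x') :=
        @IsIso.of_isIso_comp_right _ _ _ _ _ (φ.stalkMap x') (W.ι.stalkMap ⟨x', hx'⟩) h4 h2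
      haveI := hreg (φ x')
      exact IsRegularLocalRing.of_ringEquiv (asIso (φ.stalkMap x')).commRingCatIsoToRingEquiv
  haveI : LocallyOfFiniteType (φ ≫ (projectiveSpace (m + 1) k).hom) := inferInstance
  haveI hsm : Smooth (φ ≫ (projectiveSpace (m + 1) k).hom) :=
    smooth_of_isRegular_of_perfectField (φ ≫ (projectiveSpace (m + 1) k).hom) hreg'
  obtain ⟨n, hn⟩ := exists_smoothOfRelativeDimension_of_smooth (φ ≫ (projectiveSpace (m + 1) k).hom)
  have hnm : n = m + 1 := by
    haveI := hn
    let V : X'.Opens := φ ⁻¹ᵁ centreCompl J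
    haveI hoi : IsOpenImmersion (V.ι ≫ φ) := hblow.isOpenImmersion_preimage_compl_ι
    haveI : IsIso (φ ∣_ centreCompl J) := hblow.isIso_compl
    obtain ⟨x, hx⟩ := centreCompl_nonempty (J := J) hJne
    haveI : Nonempty (V : Scheme.{u}) := ⟨((asIso (φ ∣_ centreCompl J)).inv ⟨x, hx⟩ : _)⟩
    have h₁ : SmoothOfRelativeDimension n (V.ι ≫ φ ≫ (projectiveSpace (m + 1) k).hom) :=
      IsZariskiLocalAtSource.comp hn _
    have h₂ : SmoothOfRelativeDimension (0 + (m + 1)) ((V.ι ≫ φ) ≫ (projectiveSpace (m + 1) k).hom) :=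
      inferInstance
    rw [Category.assoc] at h₂
    have := AbelianVarietyProofs.eq_of_smoothOfRelativeDimension _ h₁ h₂
    omega
  haveI : SmoothOfRelativeDimension (m + 1) (φ ≫ (projectiveSpace (m + 1) k).hom) := hnm ▸ hn
  -- `X'` is projective (Hartshorne II 7.16 (c))
  have hX'proj : IsProjectiveOver (Over.mk (φ ≫ (projectiveSpace (m + 1) k).hom)) :=
    BlowupProjectiveOverField_holds k (projectiveSpace (m + 1) k).left X'
      (projectiveSpace (m + 1) k).hom J φ hint hproj hJne hblow
  -- the induction step
  exact N.nonempty_succ_of_baseChange φ f hF.comp_hom hX'proj hS hSne hSU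

/-- **Nets of `r`-folds from curve nets, by induction on `r`** (`k` algebraically closed of
characteristic `0`): if every smooth projective `(m + 1)`-fold over `k` carries a net of curves over
`ℙᵐ` (for all `m`), then every smooth projective `(m + r + 1)`-fold carries a net of `(r + 1)`-folds
over `ℙᵐ` — `FiberNet.nonempty_succ` applied `r` times. [cite: DeJong1996, Lemma 4.11 and 4.12, pp. 67–69]
[cite: Hartshorne1977, II Example 7.17.3] -/
theorem nonempty_fiberNet_succ_of_curveNets
    (hcurve : ∀ (m : ℕ) ⦃X : SchemeOver k⦄, IsSmoothProjective (m + 1) X → Nonempty (FiberNet 1 m X)) :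
    ∀ (r m : ℕ) {X : SchemeOver k}, IsSmoothProjective (m + (r + 1)) X →
      Nonempty (FiberNet (r + 1) m X)
  | 0, m, _, hX => hcurve m hX
  | r + 1, m, X, hX => by
    haveI : IsProper X.hom := hX.isProjectiveOver.isProper
    have hX' : IsSmoothProjective (m + 1 + (r + 1)) X := by
      rw [show m + 1 + (r + 1) = m + (r + 1 + 1) by omega]
      exact hX
    obtain ⟨N⟩ := nonempty_fiberNet_succ_of_curveNets hcurve r (m + 1) hX'
    exact N.nonempty_succ

end DeJong

/-! ## The named fact over `ℂ` -/

/-- **`exists_fiberNet_smoothBase_nonempty` from curve nets** (Hartshorne II Example 7.17.3 +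
II Thm. 8.18, III Cor. 10.7; here through de Jong's Lemma 4.11/4.12): if every smooth projective complex
`(m + 1)`-fold carries a net of curves over `ℙᵐ` — a THEOREM of the tree,
`nonempty_fiberNet_one_of_isAlgClosed` of `Motives/CurveNetFromLemma411`, fed in by the one-line
corollary `exists_fiberNet_smoothBase_nonempty_holds` of `Motives/FiberNetExistenceDischarge` — then
for `r ≥ 1` every smooth projective complex `(m + r)`-fold carries a net of `r`-folds over `ℙᵐ`
(`nonempty_fiberNet_succ_of_curveNets`), whose smooth base is non-empty by generic smoothness
(`exists_fiberNet_smoothBase_nonempty_of_forall_nonempty`).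
[cite: Hartshorne1977, II Example 7.17.3, II Thm. 8.18 and III Cor. 10.7]
[cite: DeJong1996, Lemma 4.11 and 4.12, pp. 67–69] -/
theorem exists_fiberNet_smoothBase_nonempty_of_curveNets
    (hcurve : ∀ (m : ℕ) ⦃X : SchemeOver ℂ⦄, IsSmoothProjective (m + 1) X → Nonempty (FiberNet 1 m X)) :
    exists_fiberNet_smoothBase_nonempty :=
  exists_fiberNet_smoothBase_nonempty_of_forall_nonempty fun r m _ hr hX => by
    obtain ⟨r', rfl⟩ : ∃ r', r = r' + 1 := Nat.exists_eq_succ_of_ne_zero (by omega)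
    exact nonempty_fiberNet_succ_of_curveNets hcurve r' m hX

/-- **`exists_fiberNet_smoothBase_nonempty` from the named fact `nonempty_curveNet`**
(`Motives/CurveNetExistence`: curve nets on smooth projective complex `(m + 1)`-folds, `1 ≤ m`),
completed in base dimension `m = 0` by the tautological net `X → ℙ⁰` (`nonempty_fiberNet_zero`). [cite: Hartshorne1977, II Example 7.17.3 and III Cor. 10.7] -/
theorem exists_fiberNet_smoothBase_nonempty_of_nonempty_curveNet (h : nonempty_curveNet) :
    exists_fiberNet_smoothBase_nonempty := by
  refine exists_fiberNet_smoothBase_nonempty_of_curveNets fun m X hX => ?_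
  rcases Nat.eq_zero_or_pos m with rfl | hm
  · exact nonempty_fiberNet_zero hX
  · obtain ⟨N⟩ := h hX hm
    exact ⟨N.toFiberNet⟩

end Literature.AlgebraicGeometry.Motives

end
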